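import Summits.CriticalPhenomena.Ising3D.TaylorKernelSymm
import Summits.CriticalPhenomena.Ising3D.TaylorHalfStripPos
import Mathlib.Tactic.Linarith
import Mathlib.Tactic.Positivity
import Mathlib.Tactic.Ring
import Mathlib.Tactic.FieldSimp
import HarnessLib

/-!
# The even-sector REGION obligation from a kernel-computable check (symmetrised kernel on the half-strip)
(cell `pub-ising3x`, seat recog-1 gen 11; gate (g2): `TaylorEvenRegion (taylorCrossing ½ ½ S w) Q E₀` for a
rational box from `decide`-able data — the region half of the TABLE theorem, kernel route)

HONEST FRAMING: lottery ticket; floor = tightest certified 3D Ising CFT bounds; no exact-solution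
claim without a proof.

Chain: `TaylorKernelSymm` (the even region follows from `K_X,sym ≥ 0`, `K_Y,sym ≥ 0`, `K_Z,sym² ≤ 4 K_X,sym K_Y,sym`
on `{u,v ≥ 0, u+v ≥ E₀}`, and `K_sym(u,v) = Σ_k row_{2k}(P) (D²)^k`, `P = u+v-cc`, `D = u-v`) + the substitution
`D² = θ (P+cc)²`, `θ = ((u-v)/(u+v))² ∈ [0,1]` (`substTheta`, `evenKernelSymm_eq_eval2_substTheta`) + the interval
tables `kernelPDLI` (`TaylorKernelPDInterval`) + the half-strip checker (`TaylorHalfStripPos`). Result: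
**`taylorEvenRegion_of_evenRegionCheck`** — for rational weights `cQ : Fin 5 → ℕ × ℕ → ℚ` on an index list `l`,
a set `Q` whose points have `Δσ ∈ sσI`, `Δε ∈ sεI`, `(Δσ+Δε)/2 ∈ sbI` (three `MI`s), a centre `ccQ` and
`E₀ = P₀ + ccQ`: `evenRegionCheck … = true → TaylorEvenRegion (taylorCrossing ½ ½ l.toFinset (↑cQ)) Q E₀`.
SUFFICIENT only (kernel route; symmetrised; interval slack). Elementary. [folklore]
-/

namespace Summit.CriticalPhenomena.Ising3D

open Finset
open Literature.Analysis.ValidatedNumerics Literature.Analysis.ValidatedNumerics.PolyMP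
open Literature.Analysis.ValidatedNumerics.NumericsMP (MI)
open Literature.MathematicalPhysics.QuantumFieldTheory.ConformalBootstrap3D

/-! ### `(P + cc)^n` as a coefficient list and the substitution `D² = θ (P + cc)²` -/

/-- The coefficients of `(P + cc)^n`. [folklore] -/
noncomputable def powShiftR (cc : ℝ) (n : ℕ) : List ℝ :=
  (List.range (n + 1)).map fun r => (n.choose r : ℝ) * cc ^ (n - r)

/-- [folklore] -/
theorem evalR_powShiftR (cc : ℝ) (n : ℕ) (P : ℝ) : evalR (powShiftR cc n) P = (P + cc) ^ n := by
  rw [powShiftR, evalR_map_range, add_pow]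
  exact Finset.sum_congr rfl fun r _ => by ring

/-- Rational twin. [folklore] -/
def powShiftQ (cc : ℚ) (n : ℕ) : List ℚ := (List.range (n + 1)).map fun r => (n.choose r : ℚ) * cc ^ (n - r)

/-- [folklore] -/
theorem map_cast_powShiftQ (cc : ℚ) (n : ℕ) : ((powShiftQ cc n).map ((↑) : ℚ → ℝ)) = powShiftR (cc : ℝ) n := by
  simp [powShiftQ, powShiftR, List.map_map, Function.comp_def]

/-- Interval twin (thin). [folklore] -/
def powShiftI (S : ℕ) (cc : ℚ) (n : ℕ) : IPoly := ofRatList S (powShiftQ cc n)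

/-- [folklore] -/
theorem pmem_powShiftI (S : ℕ) (cc : ℚ) (n : ℕ) : PMem S (powShiftR (cc : ℝ) n) (powShiftI S cc n) := by
  rw [← map_cast_powShiftQ]
  exact pmem_ofRatList S _

/-- The substituted table: row `k` is `row_{2k}(P) · (P+cc)^{2k}` (outer index = power of `θ`). [folklore] -/
noncomputable def substTheta (Q : List (List ℝ)) (cc : ℝ) (N : ℕ) : List (List ℝ) :=
  (List.range N).map fun k => mulR (Q.getD (2 * k) []) (powShiftR cc (2 * k))

/-- Interval twin of `substTheta`. [folklore] -/
def substThetaI (S : ℕ) (QI : IPoly2) (cc : ℚ) (N : ℕ) : IPoly2 :=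
  (List.range N).map fun k => mulI S (QI.getD (2 * k) []) (powShiftI S cc (2 * k))

/-- [folklore] -/
theorem pmem2_map_of_mem {S : ℕ} {ι : Type*} {f : ι → List ℝ} {F : ι → IPoly} (h : ∀ i, PMem S (f i) (F i)) :
    ∀ l : List ι, PMem2 S (l.map f) (l.map F)
  | [] => pmem2_nil S
  | i :: l => by simpa using pmem2_cons (h i) (pmem2_map_of_mem h l)

/-- [folklore] -/
theorem pmem2_substThetaI {S : ℕ} (hS : 0 < S) {Q : List (List ℝ)} {QI : IPoly2} (h : PMem2 S Q QI) (cc : ℚ)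
    (N : ℕ) : PMem2 S (substTheta Q (cc : ℝ) N) (substThetaI S QI cc N) :=
  pmem2_map_of_mem (fun k => pmem_mulI hS (pmem_getD_of_pmem2 h (2 * k)) (pmem_powShiftI S cc (2 * k))) _

/-- [folklore] -/
theorem eval2_substTheta (Q : List (List ℝ)) (cc : ℝ) (N : ℕ) (P θ : ℝ) :
    eval2 (substTheta Q cc N) P θ = ∑ k ∈ range N, evalR (Q.getD (2 * k) []) P * (P + cc) ^ (2 * k) * θ ^ k := by
  rw [eval2, substTheta, List.map_map]
  have : ((fun l => evalR l P) ∘ fun k => mulR (Q.getD (2 * k) []) (powShiftR cc (2 * k))) =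
      fun k => evalR (Q.getD (2 * k) []) P * (P + cc) ^ (2 * k) := by
    funext k
    simp only [Function.comp_apply, evalR_mulR, evalR_powShiftR]
  rw [this, evalR_map_range]

/-! ### The symmetrised kernel as `eval2` of the substituted table -/

/-- The direction variable `θ = ((u-v)/(u+v))²` (`0` at the origin). [folklore] -/
noncomputable def thetaOf (u v : ℝ) : ℝ := if u + v = 0 then 0 else ((u - v) / (u + v)) ^ 2

/-- `θ ∈ [0,1]` for `u, v ≥ 0`. [folklore] -/
theorem thetaOf_mem {u v : ℝ} (hu : 0 ≤ u) (hv : 0 ≤ v) : 0 ≤ thetaOf u v ∧ thetaOf u v ≤ 1 := by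
  unfold thetaOf
  split_ifs with h
  · exact ⟨le_rfl, zero_le_one⟩
  · refine ⟨sq_nonneg _, ?_⟩
    have hpos : 0 < u + v := lt_of_le_of_ne (add_nonneg hu hv) (Ne.symm h)
    rw [div_pow, div_le_one (by positivity)]
    nlinarith [sq_nonneg (u - v), sq_nonneg (u + v)]

/-- `(u+v)^{2k} θ^k = ((u-v)²)^k`. [folklore] -/
theorem pow_mul_thetaOf_pow {u v : ℝ} (hu : 0 ≤ u) (hv : 0 ≤ v) (k : ℕ) :
    (u + v) ^ (2 * k) * thetaOf u v ^ k = ((u - v) ^ 2) ^ k := by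
  unfold thetaOf
  split_ifs with h
  · have hu0 : u = 0 := by linarith
    have hv0 : v = 0 := by linarith
    subst hu0; subst hv0
    cases k with
    | zero => simp
    | succ k => simp
  · rw [pow_mul, ← mul_pow, div_pow]
    congr 1
    field_simp

/-- **`K_sym(u,v) = eval2 (substTheta table cc N) (u+v-cc) θ(u,v)`** for `u, v ≥ 0`, `N ≥ size2 table`. [folklore] -/
theorem evenKernelSymm_eq_eval2_substTheta (c : ℕ × ℕ → ℝ) {l : List (ℕ × ℕ)} (hl : l.Nodup) (s σ cc : ℝ)
    {N : ℕ} (hN : size2 (kernelPDL c l s σ cc) ≤ N) {u v : ℝ} (hu : 0 ≤ u) (hv : 0 ≤ v) :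
    evenKernelSymm c l.toFinset s σ u v = eval2 (substTheta (kernelPDL c l s σ cc) cc N) (u + v - cc) (thetaOf u v) := by
  rw [evenKernelSymm_eq_sum_rows c hl s σ cc hN u v, eval2_substTheta]
  refine Finset.sum_congr rfl fun k _ => ?_
  rw [show u + v - cc + cc = u + v by ring, mul_assoc, pow_mul_thetaOf_pow hu hv k]

/-! ### The even-region check -/

/-- The substituted interval table of ONE kernel `K_sym[(cQ), s ∈ sI, σQ]`. [folklore] -/
def kernelTableI (S : ℕ) (cQ : ℕ × ℕ → ℚ) (σQ : ℚ) (sI : MI) (ccQ : ℚ) (l : List (ℕ × ℕ)) (N : ℕ) : IPoly2 :=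
  substThetaI S (kernelPDLI S cQ σQ (signedChooseI S sI) ccQ l) ccQ N

/-- Its real shadow. [folklore] -/
noncomputable def kernelTable (cQ : ℕ × ℕ → ℚ) (σQ : ℚ) (s : ℝ) (ccQ : ℚ) (l : List (ℕ × ℕ)) (N : ℕ) :
    List (List ℝ) :=
  substTheta (kernelPDL (fun ab => (cQ ab : ℝ)) l s (σQ : ℝ) (ccQ : ℝ)) (ccQ : ℝ) N

/-- [folklore] -/
theorem pmem2_kernelTableI {S : ℕ} (hS : 0 < S) (cQ : ℕ × ℕ → ℚ) (σQ : ℚ) {s : ℝ} {sI : MI} (hs : MI.mem S s sI)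
    (ccQ : ℚ) (l : List (ℕ × ℕ)) (N : ℕ) :
    PMem2 S (kernelTable cQ σQ s ccQ l N) (kernelTableI S cQ σQ sI ccQ l N) :=
  pmem2_substThetaI hS (pmem2_kernelPDLI_of_mem hS hs cQ σQ ccQ l) ccQ N

/-- The size condition `size2I (kernelPDLI …) ≤ N` (so the shadow's rows all fit). [folklore] -/
def kernelSizeOK (S : ℕ) (cQ : ℕ × ℕ → ℚ) (σQ : ℚ) (sI : MI) (ccQ : ℚ) (l : List (ℕ × ℕ)) (N : ℕ) : Bool :=
  decide (size2I (kernelPDLI S cQ σQ (signedChooseI S sI) ccQ l) ≤ N)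

/-- [folklore] -/
theorem size2_le_of_kernelSizeOK {S : ℕ} (hS : 0 < S) {cQ : ℕ × ℕ → ℚ} {σQ : ℚ} {s : ℝ} {sI : MI}
    (hs : MI.mem S s sI) {ccQ : ℚ} {l : List (ℕ × ℕ)} {N : ℕ} (h : kernelSizeOK S cQ σQ sI ccQ l N = true) :
    size2 (kernelPDL (fun ab => (cQ ab : ℝ)) l s (σQ : ℝ) (ccQ : ℝ)) ≤ N := by
  rw [size2_eq_of_pmem2 (pmem2_kernelPDLI_of_mem hS hs cQ σQ ccQ l)]
  exact of_decide_eq_true h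

/-- **The kernel value through the table**: for `u, v ≥ 0`,
`K_sym[(↑cQ), s, σQ](u,v) = eval2 (kernelTable cQ σQ s ccQ l N) (u+v-ccQ) θ(u,v)`. [folklore] -/
theorem evenKernelSymm_eq_eval2_kernelTable {S : ℕ} (hS : 0 < S) (cQ : ℕ × ℕ → ℚ) (σQ : ℚ) {s : ℝ} {sI : MI}
    (hs : MI.mem S s sI) (ccQ : ℚ) {l : List (ℕ × ℕ)} (hl : l.Nodup) {N : ℕ}
    (hN : kernelSizeOK S cQ σQ sI ccQ l N = true) {u v : ℝ} (hu : 0 ≤ u) (hv : 0 ≤ v) :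
    evenKernelSymm (fun ab => (cQ ab : ℝ)) l.toFinset s (σQ : ℝ) u v =
      eval2 (kernelTable cQ σQ s ccQ l N) (u + v - ccQ) (thetaOf u v) :=
  evenKernelSymm_eq_eval2_substTheta _ hl s _ _ (size2_le_of_kernelSizeOK hS hs hN) hu hv

/-- Data of an even-region check. [folklore] -/
structure EvenRegionData where
  /-- fixed-point scale -/
  S : ℕ
  /-- index list of the functional (the certificate's `S₋ ∪ S₊` as a list) -/
  l : List (ℕ × ℕ)
  /-- rational weights of the five components (rows 0, 1, 3, 4 are used here) -/
  cQ : Fin 5 → ℕ × ℕ → ℚ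
  /-- enclosures of `Δσ`, `Δε`, `(Δσ+Δε)/2` over the box -/
  sσI : MI
  sεI : MI
  sbI : MI
  /-- centre of the `P` variable (`P = u + v - cc`) -/
  ccQ : ℚ
  /-- left end `P₀` (`E₀ = P₀ + cc`) -/
  P0 : ℚ
  /-- row count of the substituted tables -/
  N : ℕ
  /-- checker parameters for the three tests -/
  prmX : HSParams
  prmY : HSParams
  prmD : HSParams

namespace EvenRegionData

/-- The three substituted tables. [folklore] -/
def TX (d : EvenRegionData) : IPoly2 := kernelTableI d.S (d.cQ 0) (-1) d.sσI d.ccQ d.l d.N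
/-- [folklore] -/
def TY (d : EvenRegionData) : IPoly2 := kernelTableI d.S (d.cQ 1) (-1) d.sεI d.ccQ d.l d.N
/-- [folklore] -/
def TZ (d : EvenRegionData) : IPoly2 :=
  add2I (kernelTableI d.S (d.cQ 3) (-1) d.sbI d.ccQ d.l d.N) (kernelTableI d.S (d.cQ 4) 1 d.sbI d.ccQ d.l d.N)
/-- `4 T_X T_Y - T_Z²`. [folklore] -/
def TD (d : EvenRegionData) : IPoly2 :=
  add2I (smul2QI 4 (mul2I d.S d.TX d.TY)) (neg2I (mul2I d.S d.TZ d.TZ))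

/-- **The even-region check**: sizes, `θhi ≥ 1` for the three parameter sets, and the three half-strip tests.
[folklore] -/
def check (d : EvenRegionData) : Bool :=
  decide (0 < d.S) &&
  kernelSizeOK d.S (d.cQ 0) (-1) d.sσI d.ccQ d.l d.N && kernelSizeOK d.S (d.cQ 1) (-1) d.sεI d.ccQ d.l d.N &&
  kernelSizeOK d.S (d.cQ 3) (-1) d.sbI d.ccQ d.l d.N && kernelSizeOK d.S (d.cQ 4) 1 d.sbI d.ccQ d.l d.N &&
  decide (1 ≤ d.prmX.θhi) && decide (1 ≤ d.prmY.θhi) && decide (1 ≤ d.prmD.θhi) &&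
  halfStripPos d.S d.TX d.P0 d.prmX && halfStripPos d.S d.TY d.P0 d.prmY && halfStripPos d.S d.TD d.P0 d.prmD

end EvenRegionData

/-- **The even-sector region obligation from the check.** [folklore] -/
theorem taylorEvenRegion_of_evenRegionCheck (d : EvenRegionData) (hl : d.l.Nodup) (Q : Set (ℝ × ℝ))
    (hQ : ∀ p ∈ Q, MI.mem d.S p.1 d.sσI ∧ MI.mem d.S p.2 d.sεI ∧ MI.mem d.S ((p.1 + p.2) / 2) d.sbI)
    (h : d.check = true) :
    TaylorEvenRegion (taylorCrossing (1 / 2) (1 / 2) d.l.toFinset fun i ab => (d.cQ i ab : ℝ)) Q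
      ((d.P0 : ℝ) + d.ccQ) := by
  simp only [EvenRegionData.check, Bool.and_eq_true, decide_eq_true_eq] at h
  obtain ⟨⟨⟨⟨⟨⟨⟨⟨⟨⟨hS, hN0⟩, hN1⟩, hN3⟩, hN4⟩, hθX⟩, hθY⟩, hθD⟩, hX⟩, hY⟩, hD⟩ := h
  refine taylorEvenRegion_half_of_symmKernelRegion _ _ Q _ fun p hp u v hu hv hE => ?_
  obtain ⟨hsσ, hsε, hsb⟩ := hQ p hp
  have hθ := thetaOf_mem hu hv
  have hP : ((d.P0 : ℚ) : ℝ) ≤ u + v - d.ccQ := by linarith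
  -- shadows of the three tables and their values
  have eX := evenKernelSymm_eq_eval2_kernelTable hS (d.cQ 0) (-1) hsσ d.ccQ hl hN0 hu hv
  have eY := evenKernelSymm_eq_eval2_kernelTable hS (d.cQ 1) (-1) hsε d.ccQ hl hN1 hu hv
  have eZ3 := evenKernelSymm_eq_eval2_kernelTable hS (d.cQ 3) (-1) hsb d.ccQ hl hN3 hu hv
  have eZ4 := evenKernelSymm_eq_eval2_kernelTable hS (d.cQ 4) 1 hsb d.ccQ hl hN4 hu hv
  have pX := pmem2_kernelTableI hS (d.cQ 0) (-1) hsσ d.ccQ d.l d.N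
  have pY := pmem2_kernelTableI hS (d.cQ 1) (-1) hsε d.ccQ d.l d.N
  have pZ := pmem2_add2I (pmem2_kernelTableI hS (d.cQ 3) (-1) hsb d.ccQ d.l d.N)
    (pmem2_kernelTableI hS (d.cQ 4) 1 hsb d.ccQ d.l d.N)
  have pD := pmem2_add2I (pmem2_smul2QI (4 : ℚ) (r := 4) (by norm_num) (pmem2_mul2I hS pX pY))
    (pmem2_neg2I (pmem2_mul2I hS pZ pZ))
  have vX := halfStripPos_sound hS pX hX hP hθ.1 (hθ.2.trans (by exact_mod_cast hθX))
  have vY := halfStripPos_sound hS pY hY hP hθ.1 (hθ.2.trans (by exact_mod_cast hθY))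
  have vD := halfStripPos_sound hS pD hD hP hθ.1 (hθ.2.trans (by exact_mod_cast hθD))
  rw [eval2_add2, eval2_smul2, eval2_mul2, eval2_smul2, eval2_mul2, eval2_add2] at vD
  simp only [Rat.cast_neg, Rat.cast_one] at eX eY eZ3 eZ4
  have goalX : 0 ≤ evenKernelSymm (fun ab => (d.cQ 0 ab : ℝ)) d.l.toFinset p.1 (-1) u v := by
    rw [eX]; exact vX.le
  have goalY : 0 ≤ evenKernelSymm (fun ab => (d.cQ 1 ab : ℝ)) d.l.toFinset p.2 (-1) u v := by
    rw [eY]; exact vY.le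
  have goalD : (evenKernelSymm (fun ab => (d.cQ 3 ab : ℝ)) d.l.toFinset ((p.1 + p.2) / 2) (-1) u v +
      evenKernelSymm (fun ab => (d.cQ 4 ab : ℝ)) d.l.toFinset ((p.1 + p.2) / 2) 1 u v) ^ 2 ≤
      4 * evenKernelSymm (fun ab => (d.cQ 0 ab : ℝ)) d.l.toFinset p.1 (-1) u v *
        evenKernelSymm (fun ab => (d.cQ 1 ab : ℝ)) d.l.toFinset p.2 (-1) u v := by
    rw [eX, eY, eZ3, eZ4, sq]
    linarith
  exact ⟨goalX, goalY, goalD⟩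

/-- The same with the threshold read as the cast of ONE rational `E₀ = P₀ + cc` (the form boot-1's `TaylorTable`
instantiates: `T.E₀ := d.P0 + d.ccQ`). [folklore] -/
theorem taylorEvenRegion_of_evenRegionCheck_rat (d : EvenRegionData) (hl : d.l.Nodup) (Q : Set (ℝ × ℝ))
    (hQ : ∀ p ∈ Q, MI.mem d.S p.1 d.sσI ∧ MI.mem d.S p.2 d.sεI ∧ MI.mem d.S ((p.1 + p.2) / 2) d.sbI)
    (h : d.check = true) :
    TaylorEvenRegion (taylorCrossing (1 / 2) (1 / 2) d.l.toFinset fun i ab => (d.cQ i ab : ℝ)) Q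
      ((d.P0 + d.ccQ : ℚ) : ℝ) := by
  rw [Rat.cast_add]
  exact taylorEvenRegion_of_evenRegionCheck d hl Q hQ h

end Summit.CriticalPhenomena.Ising3D
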